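import Literature.MathematicalPhysics.QuantumFieldTheory.Balaban1983to89.B3DivergentGraphs

/-!
# `Balaban1983to89.B3Graph24Unique` — T. Bałaban, *(Higgs)₂,₃ quantum fields in a finite volume. III. Renormalization*,
Commun. Math. Phys. **88** (1983) 411–445 [Balaban1983Higgs3]: p. 429, *"There is only one graph with four external legs and
it is the graph (2.4)"*, DECIDED on the concrete family of graphs `B3Cor23Concrete.Graph`

statement-level skeleton of published theorems with citation tags; proofs where landed; nothing here is a claim about the Yang–Mills mass gap

PDF held: `paper:balaban1983-higgs-2-3-quantum-fields-finite-volume` (journal page = PDF page + 410); renders read as images: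
`…/b2b-balaban-ref1/pages/1983-cmp88-higgs23-III/1983-cmp88-higgs23-III-p014, p019-x2.png` (pp. 424, 429).
CITATION HEADER (lean-in-tree rule).  lit-balaban TYPED SKELETON (HOME `run/shared/lean/pub/lit-balaban/`), Phase 2, seat p18
(gen 2), unit `lit-balaban-p18`: SKELETON row **B3.Eq2.18-2.22**, first item (p. 429 [PDF 19], verbatim: *"Now we can describe
classes of divergent graphs i.e. graphs with nonpositive degree. They can be built of the vertices (1.6)–(1.8) and (1.10) only,
on the basis of the above corollary. There is only one graph with four external legs and it is the graph (2.4)."*), with row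
**B3.Eq2.4** (p. 424: *"the following special graph with a degree equal to 0"*, picture (2.4): two vertices (1.8)/(1.9), each
with one external scalar leg and one external vector leg, joined by one scalar line carrying both covariant derivatives —
reading recorded at `B3Sect2Statements.degree_graph24`, r15).  Model: `B3Cor23Concrete` (seat p18 gen 1): admissible catalogue
vertices, lines = the pairing «other endpoint» of φ′/A′-legs, attached form of the mass counterterms, D(G) = (2.2); the
external legs are counted WITH the legs of the external field Ã (`B3DivergentGraphs.numTildeLegs`; legend (1.17) p. 415), which
is how the picture (2.4) has four external legs when its vector legs are Ã-legs (in the expansion *"All the A′-legs are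
contracted"*, p. 414).

WHAT THIS MODULE PROVES (sorry-free; two `def`s with bodies = the model graphs (2.4); no `Prop` fact introduced).
EXISTENCE: `graph24` (two vertices (1.8) with n = 1, n′ = 0, the line joining the two differentiated φ′-legs; external: one
φ′-leg and the A′-leg of each vertex) and `graph24Tilde` (the same with n = 0, n′ = 1: the external vector legs are Ã-legs) are
graphs of the model with four external legs and D = 0 in every dimension d (`graph24_deg`, `graph24Tilde_deg`; cf.
`B3Sect2Statements.degree_graph24`).  UNIQUENESS (`graph24_unique`, d = 3, n̄ ≥ 1): every graph of the model with D(G) ≤ 0 and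
four external legs (φ′/A′-legs plus Ã-legs) has exactly two vertices, both of the form (1.8) with n + n′ = 1, each with exactly
its differentiated φ′-leg internal and nothing else, no line returning to its vertex, and D(G) = 0 — i.e. it is the picture
(2.4) (`graph24_unique_line`: the unique line joins the two differentiated φ′-legs).  Proof = the degree budget of
`B3DivergentGraphs` (V + E + Ã + 2·extdiffs + Σ_v[2D(v) − 1 − Ã(v)] = 2D(G) + 6) with its equality cases, and the one-vertex
graphs excluded by `ext_le_three_of_nV_eq_one`.  NOT here: connectedness is a CONSEQUENCE (two vertices, one line), not a
hypothesis; the pictures (2.18)–(2.22) (three external legs) are not enumerated.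
-/

namespace Literature.MathematicalPhysics.QuantumFieldTheory.Balaban1983to89.B3Graph24Unique

open Finset B3Prop1 B3Sect2Statements B3VertexBridge B3Cor23Concrete B3DivergentGraphs

/-! ## The graph (2.4) in the model -/

/-- The graph **(2.4)** p. 424 [PDF 14] with A′ external legs: two vertices (1.8) with n = 1, n′ = 0; the single internal line
joins the two differentiated φ′-legs (leg 0); the other φ′-leg and the A′-leg of each vertex are external (n̄ ≥ 1 for
admissibility, p. 413 *"n, n′ ≤ n̄"*). [cite: Balaban1983Higgs3, (2.4) p.424] -/
def graph24 (nbar : ℕ) (hn : 1 ≤ nbar) : Graph nbar where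
  nV := 2
  kind _ := .v18 1 0
  adm _ := by simp [VertexKind.Admissible, hn]
  other x := match x with
    | ⟨i, .inl j⟩ => if j.val = 0 then some ⟨i.rev, .inl ⟨0, by simp [VertexKind.scalarLegs]⟩⟩ else none
    | ⟨_, .inr _⟩ => none
  other_ne := by decide
  other_symm := by decide
  other_isLeft := by decide
  exists_line := by decide

/-- The graph **(2.4)** p. 424 with Ã external legs: two vertices (1.8) with n = 0, n′ = 1 (one leg of the external field Ã
each), the single internal line joining the two differentiated φ′-legs, the other φ′-legs external — the form in which (2.4)
occurs in the expansion itself (*"All the A′-legs are contracted"*, p. 414). [cite: Balaban1983Higgs3, (2.4) p.424] -/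
def graph24Tilde (nbar : ℕ) (hn : 1 ≤ nbar) : Graph nbar where
  nV := 2
  kind _ := .v18 0 1
  adm _ := by simp [VertexKind.Admissible, hn]
  other x := match x with
    | ⟨i, .inl j⟩ => if j.val = 0 then some ⟨i.rev, .inl ⟨0, by simp [VertexKind.scalarLegs]⟩⟩ else none
    | ⟨_, .inr j⟩ => j.elim0
  other_ne := by decide
  other_symm := by decide
  other_isLeft := by decide
  exists_line := by decide

variable {nbar : ℕ}

/-- kernel: (2.4) has four external legs (two φ′, two A′) and no Ã-leg. [cite: Balaban1983Higgs3, (2.4) p.424] -/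
theorem graph24_numExtLegs (hn : 1 ≤ nbar) :
    (graph24 nbar hn).numExtLegs = 4 ∧ numTildeLegs (graph24 nbar hn) = 0 := ⟨by rfl, by rfl⟩

/-- kernel: the Ã-form of (2.4) has two external φ′-legs and two Ã-legs, four external legs in all.
[cite: Balaban1983Higgs3, (2.4) p.424] -/
theorem graph24Tilde_numExtLegs (hn : 1 ≤ nbar) :
    (graph24Tilde nbar hn).numExtLegs = 2 ∧ numTildeLegs (graph24Tilde nbar hn) = 2 := ⟨by rfl, by rfl⟩

/-- p. 424 [PDF 14], verbatim: *"let us introduce the following special graph with a degree equal to 0"* — kernel: D((2.4)) = 0 in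
EVERY dimension d for the model graph (each vertex: η^d, one internal φ′-leg carrying the derivative: D_G(v) = d + (2−d)/2 − 1 =
d/2). [cite: Balaban1983Higgs3, (2.4) p.424] -/
theorem graph24_deg (d : ℕ) (hn : 1 ≤ nbar) : (graph24 nbar hn).deg d = 0 := by
  have a0 : (graph24 nbar hn).intScalar (0 : Fin 2) = 1 := by rfl
  have a1 : (graph24 nbar hn).intScalar (1 : Fin 2) = 1 := by rfl
  have b0 : (graph24 nbar hn).intVector (0 : Fin 2) = 0 := by rfl
  have b1 : (graph24 nbar hn).intVector (1 : Fin 2) = 0 := by rfl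
  have c0 : (graph24 nbar hn).intDiffs (0 : Fin 2) = 1 := by rfl
  have c1 : (graph24 nbar hn).intDiffs (1 : Fin 2) = 1 := by rfl
  rw [Graph.deg_eq]
  change (∑ i : Fin 2, (graph24 nbar hn).vertexDeg d i) - (d : ℚ) = 0
  rw [Fin.sum_univ_two, Graph.vertexDeg_eq, Graph.vertexDeg_eq, a0, a1, b0, b1, c0, c1]
  simp [graph24, VertexKind.etaCount, VertexKind.isAveragingVertex]
  ring

/-- kernel: D = 0 in every dimension for the Ã-form of (2.4) as well (η-power d + n + n′ − 1 = d again).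
[cite: Balaban1983Higgs3, (2.4) p.424] -/
theorem graph24Tilde_deg (d : ℕ) (hn : 1 ≤ nbar) : (graph24Tilde nbar hn).deg d = 0 := by
  have a0 : (graph24Tilde nbar hn).intScalar (0 : Fin 2) = 1 := by rfl
  have a1 : (graph24Tilde nbar hn).intScalar (1 : Fin 2) = 1 := by rfl
  have b0 : (graph24Tilde nbar hn).intVector (0 : Fin 2) = 0 := by rfl
  have b1 : (graph24Tilde nbar hn).intVector (1 : Fin 2) = 0 := by rfl
  have c0 : (graph24Tilde nbar hn).intDiffs (0 : Fin 2) = 1 := by rfl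
  have c1 : (graph24Tilde nbar hn).intDiffs (1 : Fin 2) = 1 := by rfl
  rw [Graph.deg_eq]
  change (∑ i : Fin 2, (graph24Tilde nbar hn).vertexDeg d i) - (d : ℚ) = 0
  rw [Fin.sum_univ_two, Graph.vertexDeg_eq, Graph.vertexDeg_eq, a0, a1, b0, b1, c0, c1]
  simp [graph24Tilde, VertexKind.etaCount, VertexKind.isAveragingVertex]
  ring

/-! ## Uniqueness among the divergent graphs with four external legs, d = 3 -/

variable (G : Graph nbar)

/-- kernel: a differentiation acting on an internal line sits on the (internal) first φ′-leg of its vertex.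
[cite: Balaban1983Higgs3, (2.1) p.422] -/
theorem isSome_of_intDiffs_pos {i : Fin G.nV} (h : 0 < G.intDiffs i) :
    ∃ h0 : 0 < (G.kind i).scalarLegs, (G.other ⟨i, .inl ⟨0, h0⟩⟩).isSome := by
  unfold Graph.intDiffs at h
  split_ifs at h with h0 hs
  · exact ⟨h0, hs⟩
  all_goals exact absurd h (lt_irrefl 0)

/-- **p. 429** [PDF 19], verbatim: *"There is only one graph with four external legs and it is the graph (2.4)."* — PROVED on the
model, d = 3, every order n̄ ≥ 1: a graph with D(G) ≤ 0 and four external legs (φ′/A′-legs and Ã-legs together) has exactly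
two vertices, both of the form (1.8) with n + n′ = 1, each with exactly one element on an internal line — its differentiated
φ′-leg —, no line with both endpoints at one vertex, and D(G) = 0 exactly.  (Vertices (1.13)–(1.15) are excluded by Cor. 2.3;
a single vertex with a returning line has at most three external legs, `B3DivergentGraphs.ext_le_three_of_nV_eq_one`; with two
vertices the degree budget is exhausted, forcing the minimal vertices and no external differentiation.)
[cite: Balaban1983Higgs3, (2.4) p.429] -/
theorem graph24_unique (hn : 1 ≤ nbar) (hD : G.deg 3 ≤ 0) (h4 : G.numExtLegs + numTildeLegs G = 4) :
    G.nV = 2 ∧ (∀ i, ∃ n n' : ℕ, G.kind i = .v18 n n' ∧ n + n' = 1)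
      ∧ (∀ i, G.intScalar i = 1 ∧ G.intVector i = 0 ∧ G.intDiffs i = 1)
      ∧ (∀ x y, G.other x = some y → y.1 ≠ x.1) ∧ G.deg 3 = 0 := by
  have h1315 := not_hasVertex1315_of_deg_nonpos G hD
  have hav := isAveragingVertex_eq_false G h1315
  have hid := two_deg_three_eq G hav
  have hterm : ∀ i, 0 ≤ 2 * degree 3 (toCounts 3 (G.kind i)) - 1 - ((G.kind i).extVectorLegs : ℚ) := fun i => by
    linarith [degree_three_ge (G.kind i) (G.adm i) (hav i)]
  have hS := sum_nonneg fun i (_ : i ∈ (univ : Finset (Fin G.nV))) => hterm i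
  have h4' : (G.numExtLegs : ℚ) + numTildeLegs G = 4 := by exact_mod_cast h4
  -- the number of vertices is 2
  have hV1 : G.nV ≠ 1 := fun h1 => by have := ext_le_three_of_nV_eq_one G hD h1; omega
  have hVpos : 1 ≤ G.nV := by obtain ⟨x, -⟩ := G.exists_line; exact Fin.pos x.1
  have hVle : (G.nV : ℚ) ≤ 2 := by
    have : (0 : ℚ) ≤ numExtDiffs G := Nat.cast_nonneg _
    linarith
  have hV : G.nV = 2 := by
    have : G.nV ≤ 2 := by exact_mod_cast hVle
    omega
  have hV' : (G.nV : ℚ) = 2 := by exact_mod_cast hV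
  -- the budget is exhausted: every bracket vanishes and no differentiation is external
  have hX : numExtDiffs G = 0 := by
    have : (numExtDiffs G : ℚ) ≤ 0 := by linarith
    exact_mod_cast le_antisymm this (Nat.cast_nonneg _)
  have hX' : (numExtDiffs G : ℚ) = 0 := by exact_mod_cast hX
  have hS0 : ∑ i, (2 * degree 3 (toCounts 3 (G.kind i)) - 1 - ((G.kind i).extVectorLegs : ℚ)) = 0 := by linarith
  have hterm0 := (sum_eq_zero_iff_of_nonneg fun i _ => hterm i).mp hS0
  have hkind : ∀ i, ∃ n n' : ℕ, G.kind i = .v18 n n' ∧ n + n' = 1 := fun i =>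
    eq_v18_of_degree_three_le hn (G.kind i) (G.adm i) (hav i) (by linarith [hterm0 i (mem_univ i)])
  -- every differentiation is internal: the first φ′-leg of each vertex is internal
  have hdiff : ∀ i, G.intDiffs i = 1 := by
    intro i
    have hle : ∀ j, G.intDiffs j ≤ (G.kind j).diffCount := fun j => G.intDiffs_le j
    have hsum : ∑ j, ((G.kind j).diffCount - G.intDiffs j) = 0 := hX
    have h0 := (sum_eq_zero_iff.mp hsum) i (mem_univ i)
    obtain ⟨n, n', hk, -⟩ := hkind i
    have hdc : (G.kind i).diffCount = 1 := by rw [hk]; rfl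
    have := hle i
    omega
  have hsc : ∀ i, 1 ≤ G.intScalar i := fun i => by
    obtain ⟨h0, hs⟩ := isSome_of_intDiffs_pos G (by rw [hdiff i]; exact Nat.one_pos)
    exact G.one_le_intScalar _ hs
  -- leg count: each vertex has 2 + n legs of φ′/A′ and n′ legs of Ã, 3 in all; 4 are external ⇒ 2 internal legs in all
  have hlegs3 : ∀ i, (G.kind i).scalarLegs + (G.kind i).vectorLegs + (G.kind i).extVectorLegs = 3 := fun i => by
    obtain ⟨n, n', hk, hnn⟩ := hkind i
    rw [hk]; simp [VertexKind.scalarLegs, VertexKind.vectorLegs, VertexKind.extVectorLegs]; omega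
  have hsumlegs : ∑ i, ((G.kind i).scalarLegs + (G.kind i).vectorLegs + (G.kind i).extVectorLegs) = 3 * G.nV := by
    rw [sum_congr rfl fun i _ => hlegs3 i, sum_const, card_univ, Fintype.card_fin, smul_eq_mul, mul_comm]
  have hsplit : ∀ i, (G.kind i).scalarLegs + (G.kind i).vectorLegs = G.extLegs i + (G.intScalar i + G.intVector i) :=
    fun i => by have := G.intScalar_le i; have := G.intVector_le i; unfold Graph.extLegs; omega
  have hint : ∑ i, (G.intScalar i + G.intVector i) = 2 := by
    have e1 : ∑ i, ((G.kind i).scalarLegs + (G.kind i).vectorLegs + (G.kind i).extVectorLegs)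
        = ∑ i, (G.extLegs i + (G.intScalar i + G.intVector i) + (G.kind i).extVectorLegs) :=
      sum_congr rfl fun i _ => by rw [hsplit i]
    rw [hsumlegs, sum_add_distrib, sum_add_distrib] at e1
    have e2 : ∑ i, G.extLegs i = G.numExtLegs := rfl
    have e3 : ∑ i, (G.kind i).extVectorLegs = numTildeLegs G := rfl
    rw [e2, e3] at e1
    omega
  -- each vertex has exactly one internal leg
  have hone : ∀ i, G.intScalar i + G.intVector i = 1 := by
    have hle : ∀ i ∈ (univ : Finset (Fin G.nV)), 1 ≤ G.intScalar i + G.intVector i :=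
      fun i _ => (hsc i).trans (Nat.le_add_right _ _)
    have heq : ∑ _i : Fin G.nV, (1 : ℕ) = ∑ i, (G.intScalar i + G.intVector i) := by
      rw [hint, sum_const, card_univ, Fintype.card_fin, smul_eq_mul, hV]
    exact fun i => ((sum_eq_sum_iff_of_le hle).mp heq i (mem_univ i)).symm
  have hinc : ∀ i, G.intScalar i = 1 ∧ G.intVector i = 0 ∧ G.intDiffs i = 1 := fun i => by
    have := hone i; have := hsc i; exact ⟨by omega, by omega, hdiff i⟩
  -- no line returns to its vertex
  have hnotad : ∀ x y, G.other x = some y → y.1 ≠ x.1 := by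
    rintro ⟨i, y⟩ z hz heq
    cases y with
    | inl j =>
      obtain ⟨i', j', rfl, hz'⟩ := G.other_scalar hz
      change i' = i at heq
      subst heq
      have hne : j ≠ j' := by rintro rfl; exact G.other_ne _ _ hz rfl
      have := two_le_intScalar G j j' hne (by simp [hz]) (by simp [hz'])
      have := (hinc i').1
      omega
    | inr j =>
      have := G.one_le_intVector j (by simp [hz])
      have := (hinc i).2.1
      omega
  refine ⟨hV, hkind, hinc, hnotad, ?_⟩
  linarith

/-- The picture (2.4) recovered: under the hypotheses of `graph24_unique`, the differentiated φ′-leg (leg 0) of every vertex lies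
on a line whose other endpoint is the differentiated φ′-leg of the OTHER vertex, and no other leg is internal.
[cite: Balaban1983Higgs3, (2.4) p.429] -/
theorem graph24_unique_line (hn : 1 ≤ nbar) (hD : G.deg 3 ≤ 0) (h4 : G.numExtLegs + numTildeLegs G = 4) (i : Fin G.nV) :
    (∃ (h0 : 0 < (G.kind i).scalarLegs) (j : Fin G.nV) (h0' : 0 < (G.kind j).scalarLegs),
        j ≠ i ∧ G.other ⟨i, .inl ⟨0, h0⟩⟩ = some ⟨j, .inl ⟨0, h0'⟩⟩)
      ∧ ∀ x : Leg G.kind, x.1 = i → (G.other x).isSome → ∃ h0 : 0 < (G.kind i).scalarLegs, x = ⟨i, .inl ⟨0, h0⟩⟩ := by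
  obtain ⟨-, -, hinc, hnotad, -⟩ := graph24_unique G hn hD h4
  have key : ∀ (i : Fin G.nV) (j : Fin (G.kind i).scalarLegs), (G.other ⟨i, .inl j⟩).isSome → j.val = 0 := by
    intro i j hj
    by_contra hne
    obtain ⟨h0, hs0⟩ := isSome_of_intDiffs_pos G (by rw [(hinc i).2.2]; exact Nat.one_pos)
    have hne' : (⟨0, h0⟩ : Fin (G.kind i).scalarLegs) ≠ j := fun h => hne (by rw [← h])
    have := two_le_intScalar G ⟨0, h0⟩ j hne' hs0 hj
    have := (hinc i).1
    omega
  constructor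
  · obtain ⟨h0, hs0⟩ := isSome_of_intDiffs_pos G (by rw [(hinc i).2.2]; exact Nat.one_pos)
    obtain ⟨y, hy⟩ := Option.isSome_iff_exists.mp hs0
    obtain ⟨j, j', rfl, hy'⟩ := G.other_scalar hy
    have hj0 := key j j' (by simp [hy'])
    have h0' : 0 < (G.kind j).scalarLegs := by have := j'.isLt; omega
    have hjj : j' = ⟨0, h0'⟩ := Fin.ext hj0
    subst hjj
    exact ⟨h0, j, h0', fun h => hnotad _ _ hy (by simpa using h), hy⟩
  · rintro ⟨i', y⟩ rfl hx
    cases y with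
    | inl j =>
      have hj0 := key _ j hx
      have h0 : 0 < (G.kind i').scalarLegs := by have := j.isLt; omega
      exact ⟨h0, by rw [show j = ⟨0, h0⟩ from Fin.ext hj0]⟩
    | inr j =>
      have := G.one_le_intVector j hx
      have := (hinc i').2.1
      omega

end Literature.MathematicalPhysics.QuantumFieldTheory.Balaban1983to89.B3Graph24Unique
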